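import Literature.NumberTheory.LFunctions.TaoLogElliottProp26
import Literature.NumberTheory.LFunctions.TaoLogElliottPrimesP
import HarnessLib

/-!
# Tao's log-averaged Elliott theorem: (2.15) and Proposition 2.6 for `𝒫_H`, in the printed form

Part of the proof DAG below the named fact `Literature.NumberTheory.LFunctions.Tao2016_theorem23_core` (Tao, Forum Math. Pi 4
(2016) e8, the proof of Theorem 2.3 from (2.10) on), in the logarithmic-probability language of
`TaoLogElliottLogAvg.lean`.  The tree proves Proposition 2.6 as an explicit inequality for an
arbitrary finite set `𝒫` of primes `p ≤ H` not dividing `a` (`Literature.NumberTheory.LFunctions.Tao2016.prop26`,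
`TaoLogElliottProp26.lean`, integrand `Trest`):
`|𝔼 F(a𝐧)| ≥ H |X| ∑_{p∈𝒫} 1/p - a² ∑ 1/p - 2|h| #𝒫 - (a² + 2aH + 2|h|H) #𝒫 (4H + 2 log H + 12)/S`,
`X = 𝔼 1_{𝐧 ≡ b (a)} g₁(𝐧) g₂(𝐧+h)`, `S = ∑_{x/ω<n≤x} 1/n`.  This file supplies the two steps around
it that the contradiction argument of §§2–3 consumes, PROVED:

* `norm_corrInd_sub_le`, `face2` — **(2.12) ⟹ (2.15)** (Lemma 2.5 with `q = a`, `r = b`): if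
  `|∑_{x/ω<n≤x} g₁(an+b) g₂(an+b+h)/n| > ε log ω` (the negation (2.8) of the conclusion of
  Theorem 2.3, literally the negated conclusion of `Literature.NumberTheory.LFunctions.Tao2016_theorem23_core`) and `S ≤ 2 log ω`,
  then `|X| ≥ ε/(2a) - (8 + 2 log a + 4|b div a|)/S`;
* `prop26_primesP` — **Proposition 2.6 as printed**, for `𝒫 = 𝒫_H = primesP ε H` (the primes of
  `[ε²H/2, ε²H]`) with the hierarchy of parameters explicit: for `0 < ε ≤ 1`, `κ > 0` with
  `96 |h| ε² ≤ κ` ("`ε` small depending on `h`"), all sufficiently large `H` (depending on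
  `a, ε, κ`: "`H ≥ H₋`"), all `x, ω` with `x/ω ≥ |h| + 1` and
  `S ≥ 48 ε² (a² + 2aH + 2|h|H)(4H + 2 log H + 12)/κ` ("`A` large depending on `H₊`"), and all
  completely multiplicative `g₁, g₂ : ℕ → S¹` with `|X| ≥ κ`:  `|𝔼 F(a𝐧)| ≥ (κ/16) H/log H`
  (from `prop26`, `∑_{p∈𝒫_H} 1/p ≥ 1/(4 log H)` (`card_primesP_ge`, "by the prime number theorem")
  and `#𝒫_H ≤ 3ε²H/log H`, `∑_{p∈𝒫_H} 1/p ≤ 6/log H` (`card_primesP_le`));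
* `prop26_of_corr` — the two combined: under (2.8) with `ε ≤ 1/(800 a (|h| + 1))`,
  `|𝔼 F(a𝐧)| ≥ (ε/(64a)) H/log H` for `H` large and `S`, `x/ω` large as above (`κ = ε/(4a)`).

## References
* T. Tao, *The logarithmically averaged Chowla and Elliott conjectures for two-point
  correlations*, Forum Math. Pi 4 (2016), e8; arXiv:1509.05422, §2: (2.8), (2.12), Lemma 2.5,
  (2.15), Proposition 2.6, and the paragraph "By shrinking `ε`, we may assume that `ε` is
  sufficiently small depending on `a, b, h`" after Theorem 2.3.

## Design choices
* `X` is `logAvg (corrInd a b h g₁ g₂) x ω` (`TaoLogElliottProp26PerPrime.lean`); the correlation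
  sum of (2.8) is written exactly as in the conclusion of `Literature.NumberTheory.LFunctions.Tao2016_theorem23_core`.
* The junk values `gᵢ 0` are only required to be `1`-bounded (as in `prop26`).
* `o_{A→∞}(1)` errors are explicit multiples of `1/S`; thresholds in `H` are packaged as
  `∀ᶠ H in atTop` for fixed `a, b, h, ε, κ` (the paper's "`H₋` sufficiently large depending on
  `a, b, h, ε`"), thresholds in `A` as explicit lower bounds for `S` and `x/ω` depending on `H`.
-/

open Finset Real Complex Filter

namespace Literature.NumberTheory.LFunctions

namespace Tao2016

variable {g₁ g₂ : ℕ → ℂ} {a : ℕ} {b h : ℤ} {x ω : ℝ}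

/-- Elements of the range exceed `R` when `x/ω ≥ R`. [folklore] -/
theorem lt_of_le_of_mem_range {R n : ℕ} (hR : (R : ℝ) ≤ x / ω) (hn : n ∈ Ioc ⌊x / ω⌋₊ ⌊x⌋₊) : R < n := by
  rw [mem_Ioc] at hn
  have h1 : x / ω < (⌊x / ω⌋₊ : ℝ) + 1 := Nat.lt_floor_add_one _
  have h2 : ((⌊x / ω⌋₊ + 1 : ℕ) : ℝ) ≤ n := by exact_mod_cast hn.1
  push_cast at h2
  exact_mod_cast (show (R : ℝ) < n by linarith)


/-- **(2.15) from (2.12)** (Lemma 2.5 with `q = a`, `r = b`):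
`|𝔼 1_{𝐧 ≡ b (a)} g₁(𝐧) g₂(𝐧+h) - (1/a) 𝔼 g₁(a𝐧+b) g₂(a𝐧+b+h)| ≤ (8 + 2 log a + 4|b div a|)/∑ 1/n`
for `1`-bounded `g₁, g₂` and `x/ω ≥ |b|`. [cite: TaoFMP2016, (2.15)] -/
theorem norm_corrInd_sub_le (hb₁ : ∀ n, ‖g₁ n‖ ≤ 1) (hb₂ : ∀ n, ‖g₂ n‖ ≤ 1) (ha : 0 < a)
    (hS : 0 < logWeightSum x ω) (hRb : (b.natAbs : ℝ) ≤ x / ω) :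
    ‖logAvg (corrInd a b h g₁ g₂) x ω
        - (1 / (a : ℂ)) * logAvg (fun n => g₁ ((a : ℤ) * n + b).toNat
            * g₂ ((a : ℤ) * n + b + h).toNat) x ω‖
      ≤ (8 + 2 * Real.log a + 4 * (b / a).natAbs) / logWeightSum x ω := by
  set G : ℕ → ℂ := fun n => g₁ n * g₂ (((n : ℤ) + h).toNat) with hG
  have hG1 : ∀ n, ‖G n‖ ≤ 1 := fun n => by
    simp only [hG]; rw [norm_mul]; exact mul_le_one₀ (hb₁ _) (norm_nonneg _) (hb₂ _)
  have hk : ((((b / a).natAbs : ℕ)) : ℝ) ≤ x / ω :=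
    le_trans (by exact_mod_cast Int.natAbs_ediv_le_natAbs b a) hRb
  have h25 := norm_logAvg_filter_modEq_sub_le hG1 ha b hS hk
  have e1 : (fun n : ℕ => if (n : ℤ) ≡ b [ZMOD a] then G n else 0) = corrInd a b h g₁ g₂ := by
    funext n; simp only [hG, corrInd]
  have e2 : logAvg (fun n => G (((a : ℤ) * n + b).toNat)) x ω
      = logAvg (fun n => g₁ ((a : ℤ) * n + b).toNat * g₂ ((a : ℤ) * n + b + h).toNat) x ω := by
    refine logAvg_congr fun n hn => ?_
    have hn : b.natAbs < n := lt_of_le_of_mem_range hRb hn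
    simp only [hG]
    congr 2
    have h0 : 0 ≤ (a : ℤ) * n + b := by
      have h1 : (n : ℤ) ≤ (a : ℤ) * n := by
        have : (1 : ℤ) ≤ a := by exact_mod_cast ha
        nlinarith
      have h2 : -b ≤ (b.natAbs : ℤ) := by
        have := Int.le_natAbs (a := -b); rwa [Int.natAbs_neg] at this
      omega
    rw [Int.toNat_of_nonneg h0]
  rw [e1, e2] at h25
  exact h25

/-- **(2.12) ⟹ (2.15), quantitatively.**  If `|∑_{x/ω<n≤x} g₁(an+b) g₂(an+b+h)/n| > ε log ω`
(the hypothesis (2.8) of the contradiction argument), `∑_{x/ω<n≤x} 1/n ≤ 2 log ω`, and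
`x/ω ≥ |b|`, then `|𝔼 1_{𝐧 ≡ b (a)} g₁(𝐧) g₂(𝐧+h)| ≥ ε/(2a) - (8 + 2 log a + 4|b div a|)/∑ 1/n`.
[cite: TaoFMP2016, (2.12) and (2.15)] -/
theorem face2 (hb₁ : ∀ n, ‖g₁ n‖ ≤ 1) (hb₂ : ∀ n, ‖g₂ n‖ ≤ 1) (ha : 0 < a)
    (hS : 0 < logWeightSum x ω) (hRb : (b.natAbs : ℝ) ≤ x / ω) {ε : ℝ} (hε : 0 ≤ ε)
    (hS2 : logWeightSum x ω ≤ 2 * Real.log ω)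
    (hcorr : ε * Real.log ω < ‖∑ n ∈ Ioc ⌊x / ω⌋₊ ⌊x⌋₊,
      g₁ ((a : ℤ) * n + b).toNat * g₂ ((a : ℤ) * n + b + h).toNat / (n : ℂ)‖) :
    ε / (2 * a) - (8 + 2 * Real.log a + 4 * (b / a).natAbs) / logWeightSum x ω
      ≤ ‖logAvg (corrInd a b h g₁ g₂) x ω‖ := by
  have ha0 : (0 : ℝ) < a := by exact_mod_cast ha
  set E := logAvg (fun n => g₁ ((a : ℤ) * n + b).toNat * g₂ ((a : ℤ) * n + b + h).toNat) x ω
    with hE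
  have h1 := norm_corrInd_sub_le (h := h) hb₁ hb₂ ha hS hRb
  rw [← hE] at h1
  -- `|E| ≥ ε/2`
  have hE2 : ε / 2 ≤ ‖E‖ := by
    rw [hE]
    unfold logAvg wsum
    rw [norm_div, Complex.norm_real, Real.norm_of_nonneg hS.le, le_div_iff₀ hS]
    have hlog : ε * Real.log ω ≥ ε / 2 * logWeightSum x ω := by nlinarith
    linarith
  have h2 : ‖(1 / (a : ℂ)) * E‖ = ‖E‖ / a := by
    rw [norm_mul, norm_div, norm_one, Complex.norm_natCast]; ring
  have h3 := norm_sub_norm_le ((1 / (a : ℂ)) * E) (logAvg (corrInd a b h g₁ g₂) x ω)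
  rw [norm_sub_rev] at h1
  rw [h2] at h3
  have h4 : ε / (2 * a) ≤ ‖E‖ / a := by
    rw [div_le_div_iff₀ (by positivity) ha0]
    nlinarith
  linarith


/-! ### Proposition 2.6 for `𝒫_H` -/

/-- **Tao 2016, Proposition 2.6, printed form** (for `𝒫_H = primesP ε H`, hierarchy explicit; see the
module docstring): if `|X| ≥ κ`, `96|h|ε² ≤ κ`, `H` is large, `x/ω ≥ |h| + 1` and
`κ S ≥ 48 ε² (a² + 2aH + 2|h|H)(4H + 2 log H + 12)`, then `|𝔼 F(a𝐧)| ≥ (κ/16) H / log H`, where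
`F(n) = ∑_{p∈𝒫_H} ∑_{j ∈ [1,H], j+ph ∈ [1,H]} c_p 1_{n+j ≡ pb (ap)} g₁(n+j) g₂(n+j+ph)` (`Trest`).
[cite: TaoFMP2016, Proposition 2.6] -/
theorem prop26_primesP (ha : 0 < a) (b h : ℤ) {ε : ℝ} (hε : 0 < ε) (hε1 : ε ≤ 1) {κ : ℝ}
    (hκ0 : 0 < κ) (hκε : 96 * (h.natAbs : ℝ) * ε ^ 2 ≤ κ) :
    ∀ᶠ H : ℕ in atTop, ∀ x ω : ℝ, 0 < logWeightSum x ω → (h.natAbs : ℝ) + 1 ≤ x / ω →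
      48 * ε ^ 2 * ((a : ℝ) ^ 2 + 2 * a * H + 2 * h.natAbs * H) * (4 * H + 2 * Real.log H + 12)
        ≤ κ * logWeightSum x ω →
      ∀ g₁ g₂ : ℕ → ℂ,
        (∀ m n : ℕ, 1 ≤ m → 1 ≤ n → g₁ (m * n) = g₁ m * g₁ n) →
        (∀ m n : ℕ, 1 ≤ m → 1 ≤ n → g₂ (m * n) = g₂ m * g₂ n) →
        (∀ n : ℕ, 1 ≤ n → ‖g₁ n‖ = 1) → (∀ n : ℕ, 1 ≤ n → ‖g₂ n‖ = 1) →
        ‖g₁ 0‖ ≤ 1 → ‖g₂ 0‖ ≤ 1 →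
        κ ≤ ‖logAvg (corrInd a b h g₁ g₂) x ω‖ →
        κ / 16 * (H / Real.log H) ≤
          ‖logAvg (fun n => Trest a b h g₁ g₂ (primesP ε H) H (a * n)) x ω‖ := by
  have ha0 : (0 : ℝ) < a := by exact_mod_cast ha
  have hε2 : 0 < ε ^ 2 := by positivity
  have c1 : ∀ᶠ H : ℕ in atTop, (4 : ℝ) ≤ ε ^ 4 * H :=
    (tendsto_natCast_atTop_atTop.const_mul_atTop (by positivity : 0 < ε ^ 4)).eventually_ge_atTop 4
  have c2 : ∀ᶠ H : ℕ in atTop, 96 * a ^ 2 / κ ≤ (H : ℝ) :=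
    tendsto_natCast_atTop_atTop.eventually_ge_atTop _
  have c3 : ∀ᶠ H : ℕ in atTop, (16 : ℝ) ≤ H := tendsto_natCast_atTop_atTop.eventually_ge_atTop 16
  have c4 : ∀ᶠ H : ℕ in atTop, 2 * (a : ℝ) + 1 ≤ ε ^ 2 * H :=
    (tendsto_natCast_atTop_atTop.const_mul_atTop hε2).eventually_ge_atTop _
  filter_upwards [c1, c2, c3, c4, card_primesP_ge hε hε1] with H hH4 hH96 hH16 hHa hPge x ω hS hR
    hSbig g₁ g₂ hg₁ hg₂ hu₁ hu₂ h0₁ h0₂ hκ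
  have hb₁ : ∀ n, ‖g₁ n‖ ≤ 1 := fun n => by
    rcases Nat.eq_zero_or_pos n with rfl | hn
    · exact h0₁
    · exact (hu₁ n hn).le
  have hb₂ : ∀ n, ‖g₂ n‖ ≤ 1 := fun n => by
    rcases Nat.eq_zero_or_pos n with rfl | hn
    · exact h0₂
    · exact (hu₂ n hn).le
  have hH16' : 16 ≤ H := by exact_mod_cast hH16
  have hH0 : (0 : ℝ) < H := by linarith
  have hlogH : 0 < Real.log H := Real.log_pos (by linarith)
  have hε21 : ε ^ 2 ≤ 1 := pow_le_one₀ hε.le hε1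
  have haH : a ≤ H := by
    have : (a : ℝ) ≤ H := by nlinarith
    exact_mod_cast this
  obtain ⟨hcard, hσle⟩ := card_primesP_le hε hε1 hH4
  obtain ⟨-, hσge⟩ := hPge
  set P := primesP ε H with hPdef
  have hP : ∀ p ∈ P, p.Prime ∧ ¬p ∣ a ∧ p ≤ H := by
    intro p hp
    obtain ⟨hpp, hp1, hp2⟩ := mem_primesP.1 hp
    refine ⟨hpp, fun hpa => ?_, ?_⟩
    · have : (p : ℝ) ≤ a := by exact_mod_cast Nat.le_of_dvd ha hpa
      linarith
    · have : (p : ℝ) ≤ H := hp2.trans (by nlinarith)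
      exact_mod_cast this
  have hne : P.Nonempty := by
    by_contra hP0
    rw [Finset.not_nonempty_iff_eq_empty] at hP0
    rw [hP0, sum_empty] at hσge
    have : (0 : ℝ) < 1 / (4 * Real.log H) := by positivity
    linarith
  have heng := prop26 hg₁ hg₂ hu₁ hu₂ hb₁ hb₂ ha hH16' haH hP hne b h hS hR
  set σ := ∑ p ∈ P, 1 / (p : ℝ) with hσ
  set N : ℝ := (P.card : ℝ) with hN
  set S := logWeightSum x ω with hSdef
  set Xn := ‖logAvg (corrInd a b h g₁ g₂) x ω‖ with hXn
  have hσ0 : 0 ≤ σ := by rw [hσ]; exact sum_nonneg fun p _ => by positivity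
  have hN0 : 0 ≤ N := Nat.cast_nonneg _
  have hL0 : 0 < 4 * (H : ℝ) + 2 * Real.log H + 12 := by positivity
  -- (i) main term
  have i1 : κ * H / (4 * Real.log H) ≤ H * σ * Xn := by
    calc κ * H / (4 * Real.log H) = H * (1 / (4 * Real.log H)) * κ := by ring
      _ ≤ H * σ * Xn := by gcongr
  -- (ii) `a² σ`
  have i2 : (a : ℝ) ^ 2 * σ ≤ κ * H / (16 * Real.log H) := by
    calc (a : ℝ) ^ 2 * σ ≤ a ^ 2 * (6 / Real.log H) := by gcongr
      _ = 6 * a ^ 2 / Real.log H := by ring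
      _ ≤ κ * H / 16 / Real.log H := by
          gcongr
          rw [div_le_iff₀ hκ0] at hH96
          linarith
      _ = κ * H / (16 * Real.log H) := by ring
  -- (iii) `2|h| N`
  have i3 : 2 * (h.natAbs : ℝ) * N ≤ κ * H / (16 * Real.log H) := by
    calc 2 * (h.natAbs : ℝ) * N ≤ 2 * h.natAbs * (3 * (ε ^ 2 * H) / Real.log H) := by gcongr
      _ = (96 * h.natAbs * ε ^ 2) * H / (16 * Real.log H) := by ring
      _ ≤ κ * H / (16 * Real.log H) := by gcongr
  -- (iv) the `1/S` error
  have i4 : ((a : ℝ) ^ 2 + 2 * a * H + 2 * h.natAbs * H) * N *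
      ((4 * H + 2 * Real.log H + 12) / S) ≤ κ * H / (16 * Real.log H) := by
    have hfrac : ε ^ 2 * ((a : ℝ) ^ 2 + 2 * a * H + 2 * h.natAbs * H) *
        ((4 * H + 2 * Real.log H + 12) / S) ≤ κ / 48 := by
      rw [← mul_div_assoc, div_le_iff₀ hS]
      linarith
    calc ((a : ℝ) ^ 2 + 2 * a * H + 2 * h.natAbs * H) * N * ((4 * H + 2 * Real.log H + 12) / S)
        ≤ ((a : ℝ) ^ 2 + 2 * a * H + 2 * h.natAbs * H) * (3 * (ε ^ 2 * H) / Real.log H) *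
            ((4 * H + 2 * Real.log H + 12) / S) := by gcongr
      _ = (ε ^ 2 * ((a : ℝ) ^ 2 + 2 * a * H + 2 * h.natAbs * H) *
            ((4 * H + 2 * Real.log H + 12) / S)) * (3 * H / Real.log H) := by ring
      _ ≤ κ / 48 * (3 * H / Real.log H) := by gcongr
      _ = κ * H / (16 * Real.log H) := by ring
  have e : κ / 16 * (H / Real.log H)
      = κ * H / (4 * Real.log H) - κ * H / (16 * Real.log H) - κ * H / (16 * Real.log H)
        - κ * H / (16 * Real.log H) := by
    field_simp; ring
  rw [e]
  linarith

/-- **(2.8) ⟹ (2.16), combined** (`face2` then `prop26_primesP` with `κ = ε/(4a)`): for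
`0 < ε ≤ 1/(800 a (|h|+1))`, all large `H`, and `x, ω` with `S = ∑_{x/ω<n≤x} 1/n ≤ 2 log ω`,
`x/ω ≥ max(|b|, |h|+1)`, `S ≥ (4a/ε)(8 + 2 log a + 4|b div a|)` and
`S ≥ 200 a ε (a² + 2aH + 2|h|H)(4H + 2 log H + 12)`: if (2.8) holds then
`|𝔼 F(a𝐧)| ≥ (ε/(64a)) H/log H`. [cite: TaoFMP2016, (2.15) and Proposition 2.6] -/
theorem prop26_of_corr (ha : 0 < a) (b h : ℤ) {ε : ℝ} (hε : 0 < ε)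
    (hεs : ε ≤ 1 / (800 * a * ((h.natAbs : ℝ) + 1))) :
    ∀ᶠ H : ℕ in atTop, ∀ x ω : ℝ, 0 < logWeightSum x ω →
      logWeightSum x ω ≤ 2 * Real.log ω →
      (b.natAbs : ℝ) ≤ x / ω → (h.natAbs : ℝ) + 1 ≤ x / ω →
      4 * a / ε * (8 + 2 * Real.log a + 4 * (b / a).natAbs) ≤ logWeightSum x ω →
      200 * a * ε * ((a : ℝ) ^ 2 + 2 * a * H + 2 * h.natAbs * H) * (4 * H + 2 * Real.log H + 12)
        ≤ logWeightSum x ω →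
      ∀ g₁ g₂ : ℕ → ℂ,
        (∀ m n : ℕ, 1 ≤ m → 1 ≤ n → g₁ (m * n) = g₁ m * g₁ n) →
        (∀ m n : ℕ, 1 ≤ m → 1 ≤ n → g₂ (m * n) = g₂ m * g₂ n) →
        (∀ n : ℕ, 1 ≤ n → ‖g₁ n‖ = 1) → (∀ n : ℕ, 1 ≤ n → ‖g₂ n‖ = 1) →
        ‖g₁ 0‖ ≤ 1 → ‖g₂ 0‖ ≤ 1 →
        ε * Real.log ω < ‖∑ n ∈ Ioc ⌊x / ω⌋₊ ⌊x⌋₊,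
          g₁ ((a : ℤ) * n + b).toNat * g₂ ((a : ℤ) * n + b + h).toNat / (n : ℂ)‖ →
        ε / (64 * a) * (H / Real.log H) ≤
          ‖logAvg (fun n => Trest a b h g₁ g₂ (primesP ε H) H (a * n)) x ω‖ := by
  have ha0 : (0 : ℝ) < a := by exact_mod_cast ha
  have ha1 : (1 : ℝ) ≤ a := by exact_mod_cast ha
  have hh0 : (0 : ℝ) ≤ h.natAbs := Nat.cast_nonneg _
  -- `ε ≤ 1`
  have hε1 : ε ≤ 1 := by
    refine hεs.trans ?_
    rw [div_le_one (by positivity)]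
    nlinarith
  set κ : ℝ := ε / (4 * a) with hκ
  have hκ0 : 0 < κ := by positivity
  have hκε : 96 * (h.natAbs : ℝ) * ε ^ 2 ≤ κ := by
    -- `96 |h| ε² ≤ ε/(4a)` iff `384 a |h| ε ≤ 1`, true as `ε ≤ 1/(800 a (|h|+1))`
    rw [hκ, le_div_iff₀ (by positivity)]
    have h1 : ε * (800 * a * ((h.natAbs : ℝ) + 1)) ≤ 1 := by
      rwa [le_div_iff₀ (by positivity)] at hεs
    nlinarith
  filter_upwards [prop26_primesP ha b h hε hε1 hκ0 hκε] with H hH x ω hS hS2 hRb hRh hS3 hS4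
    g₁ g₂ hg₁ hg₂ hu₁ hu₂ h0₁ h0₂ hcorr
  have hb₁ : ∀ n, ‖g₁ n‖ ≤ 1 := fun n => by
    rcases Nat.eq_zero_or_pos n with rfl | hn
    · exact h0₁
    · exact (hu₁ n hn).le
  have hb₂ : ∀ n, ‖g₂ n‖ ≤ 1 := fun n => by
    rcases Nat.eq_zero_or_pos n with rfl | hn
    · exact h0₂
    · exact (hu₂ n hn).le
  -- (2.15): `|X| ≥ ε/(2a) - err ≥ ε/(4a) = κ`
  have hX := face2 (h := h) hb₁ hb₂ ha hS hRb hε.le hS2 hcorr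
  have herr : (8 + 2 * Real.log a + 4 * (b / a).natAbs) / logWeightSum x ω ≤ ε / (4 * a) := by
    rw [div_le_iff₀ hS]
    have : 4 * a / ε * (8 + 2 * Real.log a + 4 * (b / a).natAbs) * ε / (4 * a)
        ≤ logWeightSum x ω * ε / (4 * a) := by gcongr
    have e : 4 * a / ε * (8 + 2 * Real.log a + 4 * (b / a).natAbs) * ε / (4 * a)
        = 8 + 2 * Real.log a + 4 * (b / a).natAbs := by field_simp
    have e2 : logWeightSum x ω * ε / (4 * a) = ε / (4 * a) * logWeightSum x ω := by ring
    rw [e, e2] at this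
    exact this
  have hκX : κ ≤ ‖logAvg (corrInd a b h g₁ g₂) x ω‖ := by
    have e : ε / (2 * a) = ε / (4 * a) + ε / (4 * a) := by ring
    rw [hκ]; linarith
  have hSbig : 48 * ε ^ 2 * ((a : ℝ) ^ 2 + 2 * a * H + 2 * h.natAbs * H) *
      (4 * H + 2 * Real.log H + 12) ≤ κ * logWeightSum x ω := by
    rw [hκ]
    have hH0 : (0 : ℝ) ≤ H := Nat.cast_nonneg _
    have hpos : 0 ≤ ((a : ℝ) ^ 2 + 2 * a * H + 2 * h.natAbs * H) * (4 * H + 2 * Real.log H + 12) := by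
      have : 0 ≤ 4 * (H : ℝ) + 2 * Real.log H + 12 := by
        rcases Nat.eq_zero_or_pos H with hH | hH
        · subst hH; simp
        · have : (1 : ℝ) ≤ H := by exact_mod_cast hH
          have := Real.log_nonneg this
          positivity
      positivity
    have h1 : 200 * a * ε * (((a : ℝ) ^ 2 + 2 * a * H + 2 * h.natAbs * H) *
        (4 * H + 2 * Real.log H + 12)) * (ε / (4 * a)) ≤ logWeightSum x ω * (ε / (4 * a)) := by
      gcongr; linarith
    have e : 200 * a * ε * (((a : ℝ) ^ 2 + 2 * a * H + 2 * h.natAbs * H) *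
        (4 * H + 2 * Real.log H + 12)) * (ε / (4 * a))
        = 50 * ε ^ 2 * ((a : ℝ) ^ 2 + 2 * a * H + 2 * h.natAbs * H) *
          (4 * H + 2 * Real.log H + 12) := by
      field_simp; ring
    rw [e] at h1
    nlinarith
  have := hH x ω hS hRh hSbig g₁ g₂ hg₁ hg₂ hu₁ hu₂ h0₁ h0₂ hκX
  have e : ε / (64 * a) * (H / Real.log H) = κ / 16 * (H / Real.log H) := by rw [hκ]; ring
  rw [e]
  exact this

end Tao2016

end Literature.NumberTheory.LFunctions
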